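import Summits.Ventures.CertifiedQuantumChemistry.Rows.SectorRows
import Summits.Ventures.CertifiedQuantumChemistry.Rows.DifferenceRows
import HarnessLib

/-!
# Ventures/CertifiedQuantumChemistry — Rows/SectorTransferRows.lean: SOUNDNESS of the
# sector-DIFFERENCE certificates `dE-direct:s` — transfer-operator inequalities between two sectors of
# ONE file, and the energy-window composition that turns a lower row of a derived table plus an upper
# row of the file into a one-sided difference row `DiffUpperRow F a′ b′ F a b t`

HONEST FRAMING (verbatim): certified bounds for a stated model Hamiltonian in a stated basis; not a
claim about the real molecule or material beyond that model.

Typer chem-type-09 (LADDER-CHEM I-TYPE slot 09 class (s); chem-lead B5-3 (2) 2026-08-26: «§6 (L1)–(L3):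
chem-type-09 types them»), from chem-solver-5's `solver/diff-sector/DESIGN.md` v0 §2–§3, §6
(sha16 adc9fbaa433b7230). ONE pinned file `F` (`Model k`), TWO sectors: source `s = (a, b)`, target
`s′ = (a′, b′)` (vertical IP `(a−1, b)`, attachment `(a+1, b)`, spin flip `(a+1, b−1)`); the row key is
`dE@fcidump:<sha8>:Na<a′>:Nb<b′>-<sha8>:Na<a>:Nb<b>` and the typed conclusion is a `DiffUpperRow F a′ b′ F a b t`
of `Rows/DifferenceRows.lean` (`E₀(F; a′, b′) − E₀(F; a, b) ≤ t`).

## §1 The transfer inequality [DESIGN §2, proved] — ONE statement for every transfer class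
For ANY operator `A` on the Fock space that maps the source sector into the target sector
(`transfer_inequality`): if `ψ` is a source-sector eigenvector of `H_F` with the sector ground energy
`E_s`, then `φ := Aψ` is a trial state in the target sector, `⟨φ, H_F φ⟩ ≥ E₀(s′)‖φ‖²` (Rayleigh–Ritz,
division-free) and `⟨ψ, A†A H_F ψ⟩ = E_s‖φ‖²` (eigen-equation), so
  `(E₀(s′) − E_s) · ‖Aψ‖² ≤ Re⟨ψ, A†(H_F A − A H_F)ψ⟩`                                      (T)
— both sides LINEAR functionals of the source state's reduced density matrices when `A` is a hole
`Σ_q c_q a_{qσ}` (the extended-Koopmans pair `G^h = ⟨A†A⟩`, `X^h = ⟨A†[H, A]⟩ = −Σ c̄_p c_q F_pq` with the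
generalized Fock matrix `F_pq` of `Literature/…/GeneralizedFockMatrix.lean`, HJO (10.8.17)/(10.8.23)), a
particle `Σ_q c_q a†_{qσ}`, or a spin flip `Σ b_pq a†_{p↑}a_{q↓}` (Feynman–Bijl single-mode form).
The sector maps of the three classes are `transferHole_isInSector_up/_down`, `transferParticle_…`,
`transferSpinRaise_isInSector` (from the tree's ladder lemmas `IsInSector.annihilation_up_mulVec` etc.).

## §2 The certificate [DESIGN §3, proved] — energy-window (Lagrangian) composition, class-generic
`diffUpperRow_of_transfer_window`: let `G`, `X` be operators with the transfer inequality (T) in the form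
«for every unit source-sector ground eigenvector `ψ`: `(E₀(s′) − E₀(s))·Re⟨ψ, Gψ⟩ ≤ Re⟨ψ, Xψ⟩` and
`0 ≤ Re⟨ψ, Gψ⟩`» (`G = A†A`, `X = Herm(A†[H, A])` or any operators with the same real expectations), and
let `K` be a model whose Hamiltonian IS `μ·H_F + t·G − X` (the derived exact-rational table
`K = μ·F + t·𝔾 − 𝕏` of DESIGN §4; the table identity is (L2), supplied per class). Then a certified
LOWER row `ℓ ≤ E₀(K; s)` (FORMAT-qcl1, readers A∧B — the SAME object as an absolute leg), a certified
UPPER row `E₀(F; s) ≤ u`, `μ ≥ 0` and the strict margin `μ·u < ℓ` prove `E₀(s′) − E₀(s) ≤ t`: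
`ℓ ≤ ⟨K⟩_ψ = μE_s + t⟨G⟩ − ⟨X⟩ ≤ μu + t⟨G⟩ − ⟨X⟩`, so `t⟨G⟩ − ⟨X⟩ > 0`, and with (T)
`(t − ΔE)⟨G⟩ ≥ t⟨G⟩ − ⟨X⟩ > 0`, forcing `⟨G⟩ > 0` and `ΔE < t` (the strict margin replaces a separate
certificate that the Koopmans state is nonzero). The LOWER side of a two-sector bracket is the same
claim for the reverse transfer (`diffLowerRow_of_transfer_window`, via `diffUpperRow_iff_diffLowerRow_swap`).

What is NOT here: the derived TABLES `𝔾_B`, `𝕏_B` as `Model k` objects and their Hamiltonian identities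
((L2), DESIGN §4.1–§4.2 — one `Model.transfer` per class, sibling of `Model.lincomb`; to be typed with
chem-type-01 once job diag-s1 fixes the 8-fold symmetry question of the spin-flip table); the
`min(E₀(a−1,b), E₀(a,b−1))` packaging of the spin-summed hole functional (two applications of (T) +
`Model.energy_le_energy_of_max_le`); any certificate instance, number or claim node. Docstring locators
for the printed neighbours (ESTIMATORS in print, never certificates): extended Koopmans theorem,
Morrell–Parr–Levy, J. Chem. Phys. 62 (1975) 549 / Smith–Day, J. Chem. Phys. 62 (1975) 113; single-mode
(Feynman–Bijl) gap bound, Arovas–Auerbach–Haldane, PRL 60 (1988) 531; HJO §10.8.3 (generalized Fock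
matrix) — as recorded in DESIGN §2 by chem-solver-5 and chem-lit-1 §1.9 (E); the Lean content below is
elementary operator algebra + Rayleigh–Ritz and cites the tree.
-/

noncomputable section

namespace Summit.Ventures.CertifiedQuantumChemistry

open Matrix Finset
open Literature.MathematicalPhysics.QuantumLattice Literature.MathematicalPhysics.QuantumChemistry
open Literature.MathematicalPhysics.QuantumLattice.EigenvalueContinuation
open scoped ComplexOrder

variable {k : ℕ}

/-! ## §1 The transfer inequality -/

/-- **THE TRANSFER INEQUALITY** (DESIGN §2, all classes at once). For a symmetric model `F`, an operator
`A` on the Fock space mapping the source sector `(a, b)` into the target sector `(a′, b′)`, and a vector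
`ψ` of the source sector with `H_F ψ = E₀(F; a, b)·ψ` (a source-sector ground eigenvector — or any
eigenvector with that eigenvalue):
`(E₀(F; a′, b′) − E₀(F; a, b)) · Re⟨Aψ, Aψ⟩ ≤ Re⟨ψ, A†(H_F A − A H_F)ψ⟩`.
(`Aψ` is a Rayleigh–Ritz trial state of the target sector — the tree's division-free
`sectorGroundEnergy_mul_le_re_rayleigh` — and `⟨ψ, A†A H_Fψ⟩ = E₀(s)·‖Aψ‖²` by the eigen-equation.)
Hole `A = Σ c_q a_{qσ}`: the extended-Koopmans inequality `IP·G^h ≤ X^h`; particle: its twin; spin flip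
`A = Σ b_pq a†_{p↑}a_{q↓}`: the single-mode (Feynman–Bijl) gap bound — in print as estimators
(Morrell–Parr–Levy 1975; Arovas–Auerbach–Haldane 1988), here an inequality on the exact state, per
chem-solver-5 DESIGN §2. [folklore] -/
theorem transfer_inequality {F : Model k} (hF : F.IsSymmetric) {a b a' b' : ℕ} (A : Op k)
    (hA : ∀ v : Fock (Orb (Fin k)), IsInSector a b v → IsInSector a' b' (A *ᵥ v))
    {ψ : Fock (Orb (Fin k))} (hψ : IsInSector a b ψ)
    (hHψ : F.hamiltonian *ᵥ ψ = ((F.energy a b : ℝ) : ℂ) • ψ) :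
    (F.energy a' b' - F.energy a b) * (star (A *ᵥ ψ) ⬝ᵥ (A *ᵥ ψ)).re ≤
      (star ψ ⬝ᵥ (Aᴴ * (F.hamiltonian * A - A * F.hamiltonian)) *ᵥ ψ).re := by
  have hH : F.hamiltonian.IsHermitian := Model.hamiltonian_isHermitian hF
  -- Rayleigh–Ritz for the transferred state in the target sector
  have hRR := sectorGroundEnergy_mul_le_re_rayleigh hH (hA ψ hψ)
  -- `⟨ψ, A†(HA − AH)ψ⟩ = ⟨Aψ, H Aψ⟩ − E_s ⟨Aψ, Aψ⟩`
  have hid : star ψ ⬝ᵥ (Aᴴ * (F.hamiltonian * A - A * F.hamiltonian)) *ᵥ ψ =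
      star (A *ᵥ ψ) ⬝ᵥ (F.hamiltonian *ᵥ (A *ᵥ ψ)) -
        ((F.energy a b : ℝ) : ℂ) * (star (A *ᵥ ψ) ⬝ᵥ (A *ᵥ ψ)) := by
    calc star ψ ⬝ᵥ (Aᴴ * (F.hamiltonian * A - A * F.hamiltonian)) *ᵥ ψ
        = star (A *ᵥ ψ) ⬝ᵥ ((F.hamiltonian * A - A * F.hamiltonian) *ᵥ ψ) := by
          rw [← mulVec_mulVec, dotProduct_mulVec, star_mulVec]
      _ = star (A *ᵥ ψ) ⬝ᵥ (F.hamiltonian *ᵥ (A *ᵥ ψ)) -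
            ((F.energy a b : ℝ) : ℂ) * (star (A *ᵥ ψ) ⬝ᵥ (A *ᵥ ψ)) := by
          rw [sub_mulVec, ← mulVec_mulVec, ← mulVec_mulVec, hHψ, mulVec_smul, dotProduct_sub,
            dotProduct_smul, smul_eq_mul]
  have hre : (star ψ ⬝ᵥ (Aᴴ * (F.hamiltonian * A - A * F.hamiltonian)) *ᵥ ψ).re =
      (star (A *ᵥ ψ) ⬝ᵥ (F.hamiltonian *ᵥ (A *ᵥ ψ))).re -
        F.energy a b * (star (A *ᵥ ψ) ⬝ᵥ (A *ᵥ ψ)).re := by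
    rw [hid, Complex.sub_re, Complex.re_ofReal_mul]
  rw [hre]
  have e : (F.energy a' b' - F.energy a b) * (star (A *ᵥ ψ) ⬝ᵥ (A *ᵥ ψ)).re =
      F.energy a' b' * (star (A *ᵥ ψ) ⬝ᵥ (A *ᵥ ψ)).re -
        F.energy a b * (star (A *ᵥ ψ) ⬝ᵥ (A *ᵥ ψ)).re := by ring
  rw [e]
  exact sub_le_sub_right hRR _

/-! ### Sector maps of the three transfer classes (hole, particle, spin flip) -/

/-- A finite sum of sector vectors is a sector vector. [folklore] -/
private theorem isInSector_finset_sum {a b : ℕ} {ι : Type*} (s : Finset ι)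
    (f : ι → Fock (Orb (Fin k))) (h : ∀ i ∈ s, IsInSector a b (f i)) :
    IsInSector a b (∑ i ∈ s, f i) := fun x hx => by
  rw [Finset.sum_apply]
  exact Finset.sum_eq_zero fun i hi => h i hi x hx

/-- **HOLE transfer, spin up**: the orbital-combination annihilator `a_{c↑} = Σ_q c_q a_{q↑}` maps the
sector `(a + 1, b)` to `(a, b)` (the tree's `IsInSector.annihilation_up_mulVec`, by linearity). With
`transfer_inequality`: the up-spin leg of the extended-Koopmans inequality (DESIGN §2.1). [folklore] -/
theorem transferHole_isInSector_up {a b : ℕ} (c : Fin k → ℂ) {ψ : Fock (Orb (Fin k))}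
    (hψ : IsInSector (a + 1) b ψ) :
    IsInSector a b ((∑ q : Fin k, c q • annihilation (orb q 0)) *ᵥ ψ) := by
  rw [Matrix.sum_mulVec]
  exact isInSector_finset_sum _ _ fun q _ => by
    rw [smul_mulVec]
    exact (hψ.annihilation_up_mulVec q).smul _

/-- **HOLE transfer, spin down**: `a_{c↓} = Σ_q c_q a_{q↓}` maps `(a, b + 1)` to `(a, b)`
(`IsInSector.annihilation_down_mulVec`). [folklore] -/
theorem transferHole_isInSector_down {a b : ℕ} (c : Fin k → ℂ) {ψ : Fock (Orb (Fin k))}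
    (hψ : IsInSector a (b + 1) ψ) :
    IsInSector a b ((∑ q : Fin k, c q • annihilation (orb q 1)) *ᵥ ψ) := by
  rw [Matrix.sum_mulVec]
  exact isInSector_finset_sum _ _ fun q _ => by
    rw [smul_mulVec]
    exact (hψ.annihilation_down_mulVec q).smul _

/-- **PARTICLE transfer, spin up**: `a†_{c↑} = Σ_q c_q a†_{q↑}` maps `(a, b)` to `(a + 1, b)`
(`IsInSector.creation_up_mulVec`; DESIGN §2.2). [folklore] -/
theorem transferParticle_isInSector_up {a b : ℕ} (c : Fin k → ℂ) {ψ : Fock (Orb (Fin k))}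
    (hψ : IsInSector a b ψ) :
    IsInSector (a + 1) b ((∑ q : Fin k, c q • creation (orb q 0)) *ᵥ ψ) := by
  rw [Matrix.sum_mulVec]
  exact isInSector_finset_sum _ _ fun q _ => by
    rw [smul_mulVec]
    exact (hψ.creation_up_mulVec q).smul _

/-- **PARTICLE transfer, spin down**: `a†_{c↓}` maps `(a, b)` to `(a, b + 1)`
(`IsInSector.creation_down_mulVec`). [folklore] -/
theorem transferParticle_isInSector_down {a b : ℕ} (c : Fin k → ℂ) {ψ : Fock (Orb (Fin k))}
    (hψ : IsInSector a b ψ) :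
    IsInSector a (b + 1) ((∑ q : Fin k, c q • creation (orb q 1)) *ᵥ ψ) := by
  rw [Matrix.sum_mulVec]
  exact isInSector_finset_sum _ _ fun q _ => by
    rw [smul_mulVec]
    exact (hψ.creation_down_mulVec q).smul _

/-- **SPIN-FLIP transfer (raising `S_z`)**: `B = Σ_pq b_pq a†_{p↑} a_{q↓}` maps `(a, b + 1)` to
`(a + 1, b)` (DESIGN §2.3; Feynman–Bijl single-mode operator). [folklore] -/
theorem transferSpinRaise_isInSector {a b : ℕ} (bm : Fin k → Fin k → ℂ) {ψ : Fock (Orb (Fin k))}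
    (hψ : IsInSector a (b + 1) ψ) :
    IsInSector (a + 1) b
      ((∑ p : Fin k, ∑ q : Fin k, bm p q • (creation (orb p 0) * annihilation (orb q 1))) *ᵥ ψ) := by
  rw [Matrix.sum_mulVec]
  refine isInSector_finset_sum _ _ fun p _ => ?_
  rw [Matrix.sum_mulVec]
  exact isInSector_finset_sum _ _ fun q _ => by
    rw [smul_mulVec, ← mulVec_mulVec]
    exact ((hψ.annihilation_down_mulVec q).creation_up_mulVec p).smul _

/-- **SPIN-FLIP transfer (lowering `S_z`)**: `B′ = Σ_pq b_pq a†_{p↓} a_{q↑}` maps `(a + 1, b)` to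
`(a, b + 1)` (DESIGN §2.4). [folklore] -/
theorem transferSpinLower_isInSector {a b : ℕ} (bm : Fin k → Fin k → ℂ) {ψ : Fock (Orb (Fin k))}
    (hψ : IsInSector (a + 1) b ψ) :
    IsInSector a (b + 1)
      ((∑ p : Fin k, ∑ q : Fin k, bm p q • (creation (orb p 1) * annihilation (orb q 0))) *ᵥ ψ) := by
  rw [Matrix.sum_mulVec]
  refine isInSector_finset_sum _ _ fun p _ => ?_
  rw [Matrix.sum_mulVec]
  exact isInSector_finset_sum _ _ fun q _ => by
    rw [smul_mulVec, ← mulVec_mulVec]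
    exact ((hψ.annihilation_up_mulVec q).creation_down_mulVec p).smul _

/-! ## §2 The energy-window composition: transfer certificate ⇒ one-sided difference row -/

/-- The Rayleigh quotient of the derived Hamiltonian `μ·H_F + t·G − X` splits accordingly. [folklore] -/
private theorem re_rayleigh_window (H G X : Op k) (μ t : ℚ) (ψ : Fock (Orb (Fin k))) :
    (star ψ ⬝ᵥ (((μ : ℚ) : ℂ) • H + ((t : ℚ) : ℂ) • G - X) *ᵥ ψ).re =
      (μ : ℝ) * (star ψ ⬝ᵥ H *ᵥ ψ).re + (t : ℝ) * (star ψ ⬝ᵥ G *ᵥ ψ).re -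
        (star ψ ⬝ᵥ X *ᵥ ψ).re := by
  rw [sub_mulVec, add_mulVec, smul_mulVec, smul_mulVec, dotProduct_sub, dotProduct_add,
    dotProduct_smul, dotProduct_smul, smul_eq_mul, smul_eq_mul, Complex.sub_re, Complex.add_re,
    ← Complex.ofReal_ratCast, ← Complex.ofReal_ratCast, Complex.re_ofReal_mul, Complex.re_ofReal_mul]

/-- **THE `dE-direct:s` CERTIFICATE IS SOUND** (DESIGN §3, class-generic). Let `F` be a symmetric model,
`(a, b)` the source sector, `(a′, b′)` a target sector in range, and `G`, `X` operators for which the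
transfer inequality holds at EVERY unit source-sector ground eigenvector `ψ` of `H_F`:
`(E₀(F; a′, b′) − E₀(F; a, b))·Re⟨ψ, Gψ⟩ ≤ Re⟨ψ, Xψ⟩` with `0 ≤ Re⟨ψ, Gψ⟩` (from `transfer_inequality`
with `G = A†A`, `X` the Hermitian part of `A†(H_F A − A H_F)`). Let `K` be a symmetric model with
`Ĥ(K) = μ·H_F + t·G − X` (the derived exact-rational table `μ·F + t·𝔾 − 𝕏`). Then a certified LOWER row
`ℓ ≤ E₀(K; a, b)`, a certified UPPER row `E₀(F; a, b) ≤ u`, `0 ≤ μ` and the strict margin `μ·u < ℓ`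
prove `DiffUpperRow F a′ b′ F a b t`, i.e. `E₀(F; a′, b′) − E₀(F; a, b) ≤ t`. (At the source ground
state: `ℓ ≤ ⟨K⟩ = μE_s + t⟨G⟩ − ⟨X⟩ ≤ μu + t⟨G⟩ − ⟨X⟩`, so `t⟨G⟩ − ⟨X⟩ > 0`; if `ΔE > t` the transfer
inequality would give `⟨X⟩ ≥ ΔE⟨G⟩ ≥ t⟨G⟩`, a contradiction.) In-house: chem-solver-5 DESIGN §3
«CLAIM: LowerRow(K, s, ℓ) ∧ UpperRow(F, s, u) ∧ ℓ − μ·u > 0 ⟹ E₀(s′) − E₀(s) < t». [folklore] -/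
theorem diffUpperRow_of_transfer_window {F K : Model k} (hF : F.IsSymmetric) (hKs : K.IsSymmetric)
    {a b a' b' : ℕ} (ha' : a' ≤ k) (hb' : b' ≤ k) (G X : Op k) {μ t ℓ u : ℚ}
    (hK : K.hamiltonian = ((μ : ℚ) : ℂ) • F.hamiltonian + ((t : ℚ) : ℂ) • G - X)
    (htransfer : ∀ ψ : Fock (Orb (Fin k)), IsInSector a b ψ → star ψ ⬝ᵥ ψ = 1 →
      F.hamiltonian *ᵥ ψ = ((F.energy a b : ℝ) : ℂ) • ψ →
        (F.energy a' b' - F.energy a b) * (star ψ ⬝ᵥ G *ᵥ ψ).re ≤ (star ψ ⬝ᵥ X *ᵥ ψ).re ∧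
          0 ≤ (star ψ ⬝ᵥ G *ᵥ ψ).re)
    (hL : LowerRow K a b ℓ) (hU : UpperRow F a b u) (hμ : 0 ≤ μ) (hmargin : μ * u < ℓ) :
    DiffUpperRow F a' b' F a b t := by
  obtain ⟨ha, hb, hℓ⟩ := hL
  refine ⟨⟨ha', hb'⟩, ⟨ha, hb⟩, ?_⟩
  -- a unit source-sector ground eigenvector of `H_F`
  obtain ⟨ψ, hψ, hψ1, hHψ⟩ := exists_unit_eigen_sectorGroundEnergy (Model.hamiltonian_isHermitian hF)
    (by simpa using ha) (by simpa using hb)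
  change F.hamiltonian *ᵥ ψ = ((F.energy a b : ℝ) : ℂ) • ψ at hHψ
  -- `ℓ ≤ ⟨ψ, Ĥ(K) ψ⟩ = μ E_s + t ⟨G⟩ − ⟨X⟩`
  have hKray := sectorGroundEnergy_mul_le_re_rayleigh (Model.hamiltonian_isHermitian hKs) hψ
  rw [hψ1, Complex.one_re, mul_one] at hKray
  change K.energy a b ≤ _ at hKray
  rw [hK, re_rayleigh_window, re_star_dotProduct_mulVec_of_eigen hHψ, hψ1, Complex.one_re,
    mul_one] at hKray
  set g := (star ψ ⬝ᵥ G *ᵥ ψ).re with hg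
  set x := (star ψ ⬝ᵥ X *ᵥ ψ).re with hx
  obtain ⟨hT, hg0⟩ := htransfer ψ hψ hψ1 hHψ
  have hu := hU.le
  have hμ' : (0 : ℝ) ≤ μ := by exact_mod_cast hμ
  have hm' : (μ : ℝ) * u < ℓ := by exact_mod_cast hmargin
  have hμE : (μ : ℝ) * F.energy a b ≤ (μ : ℝ) * u := mul_le_mul_of_nonneg_left hu hμ'
  have hpos : 0 < (t : ℝ) * g - x := by linarith
  -- conclude `ΔE ≤ t`
  by_contra hnot
  push Not at hnot
  have hlt : ((t : ℚ) : ℝ) < F.energy a' b' - F.energy a b := by exact_mod_cast hnot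
  have h1 : (t : ℝ) * g ≤ (F.energy a' b' - F.energy a b) * g :=
    mul_le_mul_of_nonneg_right (by exact_mod_cast hlt.le) hg0
  linarith

/-- **LOWER side of a two-sector bracket = the reverse transfer** (DESIGN §2.5): a transfer-window
certificate for the transfer FROM `(a′, b′)` TO `(a, b)` bounding `E₀(F; a, b) − E₀(F; a′, b′) ≤ t′`
(`diffUpperRow_of_transfer_window` with the sectors exchanged) is the difference LOWER row
`−t′ ≤ E₀(F; a′, b′) − E₀(F; a, b)` (`Rows/DifferenceRows.diffUpperRow_iff_diffLowerRow_swap`).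
[folklore] -/
theorem diffLowerRow_of_transfer_window {F K : Model k} (hF : F.IsSymmetric) (hKs : K.IsSymmetric)
    {a b a' b' : ℕ} (ha' : a' ≤ k) (hb' : b' ≤ k) (G X : Op k) {μ t ℓ u : ℚ}
    (hK : K.hamiltonian = ((μ : ℚ) : ℂ) • F.hamiltonian + ((t : ℚ) : ℂ) • G - X)
    (htransfer : ∀ ψ : Fock (Orb (Fin k)), IsInSector a b ψ → star ψ ⬝ᵥ ψ = 1 →
      F.hamiltonian *ᵥ ψ = ((F.energy a b : ℝ) : ℂ) • ψ →
        (F.energy a' b' - F.energy a b) * (star ψ ⬝ᵥ G *ᵥ ψ).re ≤ (star ψ ⬝ᵥ X *ᵥ ψ).re ∧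
          0 ≤ (star ψ ⬝ᵥ G *ᵥ ψ).re)
    (hL : LowerRow K a b ℓ) (hU : UpperRow F a b u) (hμ : 0 ≤ μ) (hmargin : μ * u < ℓ) :
    DiffLowerRow F a b F a' b' (-t) :=
  (diffUpperRow_iff_diffLowerRow_swap F a' b' F a b t).1
    (diffUpperRow_of_transfer_window hF hKs ha' hb' G X hK htransfer hL hU hμ hmargin)

/-- **The transfer hypothesis of `diffUpperRow_of_transfer_window` from an explicit transfer
operator**: for `G = A†A` and any `X` whose form agrees in real part with `A†(H_F A − A H_F)` on the
source sector (e.g. its Hermitian part — the object whose TABLE a producer writes), the pair `(G, X)`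
satisfies the transfer inequality with `⟨G⟩ ≥ 0` at every source-sector ground eigenvector
(`transfer_inequality`). [folklore] -/
theorem transfer_window_hypothesis {F : Model k} (hF : F.IsSymmetric) {a b a' b' : ℕ} (A X : Op k)
    (hA : ∀ v : Fock (Orb (Fin k)), IsInSector a b v → IsInSector a' b' (A *ᵥ v))
    (hX : ∀ v : Fock (Orb (Fin k)), IsInSector a b v →
      (star v ⬝ᵥ X *ᵥ v).re = (star v ⬝ᵥ (Aᴴ * (F.hamiltonian * A - A * F.hamiltonian)) *ᵥ v).re) :
    ∀ ψ : Fock (Orb (Fin k)), IsInSector a b ψ → star ψ ⬝ᵥ ψ = 1 →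
      F.hamiltonian *ᵥ ψ = ((F.energy a b : ℝ) : ℂ) • ψ →
        (F.energy a' b' - F.energy a b) * (star ψ ⬝ᵥ (Aᴴ * A) *ᵥ ψ).re ≤ (star ψ ⬝ᵥ X *ᵥ ψ).re ∧
          0 ≤ (star ψ ⬝ᵥ (Aᴴ * A) *ᵥ ψ).re := by
  intro ψ hψ _ hHψ
  have hG : star ψ ⬝ᵥ (Aᴴ * A) *ᵥ ψ = star (A *ᵥ ψ) ⬝ᵥ (A *ᵥ ψ) := by
    rw [← mulVec_mulVec, dotProduct_mulVec, star_mulVec]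
  rw [hG, hX ψ hψ]
  exact ⟨transfer_inequality hF A hA hψ hHψ, re_star_dotProduct_self_nonneg _⟩

end Summit.Ventures.CertifiedQuantumChemistry

end
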